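import Summits.BirchSwinnertonDyer.Rank1Residual.GaloisImage.ContinuousH1CoefficientTransport
import Summits.BirchSwinnertonDyer.Rank1Residual.GaloisImage.PropagatedConditionStableRangeAdditiveThree
import HarnessLib

/-!
# Kolyvagin's derivative classes under a change of coefficients, and THEOREM B of row T-DER at the
# place `3` for the derivative class of depth `3^{k+1}` ITSELF on additive rows (row T-DER-BP FILE 4;
# cell `b2b-bsdres`, team n1011, seat p13 GEN 12; skeleton `cells/n1011/skel/T-DER-BP.md`)

HONEST FRAMING (cell `b2b-bsdres`, run/shared/lean/b2b/bsd-rank1-residual/, verbatim in every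
file): the goal of the cell is to DELETE the COMBINATION-SHAPED residual classes of the
Birch–Swinnerton-Dyer formula for ALL analytic-rank `≤ 1` elliptic curves over `ℚ` — "full BSD
formula for every rank `≤ 1` curve in class `C`" assembled STRICTLY from published theorems — so
that the rank-`≤ 1` remainder becomes exactly the CONSTRUCTION-SHAPED classes, which are TYPED
(missing-input `Prop`s), NOT attempted. This is not "finishing BSD". Team n1011: research route on
the CONSTRUCTION-SHAPED class X4 / §I N11 (route-1 PORT, (P-DER) THEOREM B at the place `3`); TOOL
theorems of continuous group cohomology — no Euler system is asserted (none even enters: only the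
SHAPE "`res_U κ = D_r x`" of a derivative class), no definition, no named fact, no `sorry`; nothing
is booked; no mark / label / count moves.

## What, and why

Files 2/3b of this row (`PropagatedConditionStableRangeThree`, `…AdditiveThree`) prove, for `E/ℚ`
additive at `3`: every class of the form `r_* c`, `c ∈ H¹(ℚ, E[3^m·3])`, `r : E[3^m·3] → E[3^k·3]` the
reduction, `m ≥ k + 2`, has `loc₃ (r_* c) ∈ 𝓕_can(E[3^k·3])₃` — and say explicitly that they do NOT
claim the depth-`3^{k+1}` Kolyvagin derivative class IS such a reduction.  This file supplies that
missing step, in the generality in which it is true (any group, any coefficients), and draws the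
consequence:
* §1 (generic `G`, ring `R`, a morphism of representations `π : X ⟶ Y`): `π_*` on `H¹` is computed on
  cocycles (`map_id_oneCocycleClass`), is functorial (`map_id_comp_apply`), commutes with restriction
  to a subgroup (`map_resSubgroup_comm`) and with Kolyvagin's derivative operator
  `D_r = ∏_{ℓ∈r} Σ_{j<N_ℓ} j σ_ℓ^j` on `H¹(U, ·)` (`map_noncommProd_deriv_comm`; n1011-p13 GZ-1
  `CoeffTransport.comm_noncommProd_deriv_conjMap`); hence **`res_U κ = D_r x ⟹ res_U (π_*κ) = D_r (π_*x)`**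
  (`resSubgroup_map_eq_noncommProd_deriv`) and, when the derivative class for `π_* x` is unique
  (THEOREM A3 `Derivative.existsUnique_res_eq_deriv`, from `Y^U = 0`), **`π_* κ_X = κ_Y`**
  (`map_eq_of_existsUnique_res_eq_deriv`) — Rubin, *Euler Systems* (2000), Def. 4.4.4 / Lemma 4.4.2,
  under a change of the coefficient module;
* §2 (`E/F`, any prime `p`): the derivative classes read in `H¹(Γ_F, E[M])` at two depths
  `p^{m+1}`, `p^{k+1}` (transports from `H¹(U, T_pE)` computed on cocycles by `a ↦ a_{m+1}`, `a ↦ a_{k+1}`,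
  as GZ-2's `Φ ∘ red_*`) satisfy **`π_* κ_m = κ_k`** for any coefficient map `π` acting as `p^{m−k}`
  (`EC.map_eq_of_res_eq_deriv`; the cocycle identity is `p^{m−k}·a_{m+1} = a_{k+1}`,
  `TateModule.pow_smul_proj_add`);
* §3 (`E/ℚ`, `p = 3`, additive at `v ∣ 3`): with FILE 3b, **`loc₃ κ_k ∈ 𝓕_can(E[3^k·3])₃` for THE
  derivative class of depth `3^{k+1}` whenever it is built at a level where the depth-`3^{m+1}` class
  exists, `m ≥ k + 2`** (`EC.localization_mem_propagatedSelmerStructure_three_of_res_eq_deriv_of_hasAdditiveReductionAt`)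
  — THEOREM B of row T-DER at the place `3` for the derivative classes themselves on `t > 0` rows,
  binder-free (no `E(ℚ₃)[3] = 0`), the input DICT3's clause C0 at `v₃` wants for Kolyvagin primes of
  level `≥ k + 2` (ROUTE-1 §47, depth datum D-N₀; Mazur–Rubin, *Kolyvagin systems*, App. A Prop. A.2
  asserts the existence of a deep enough level; the explicit `k + 2` is FILE 3a/3b's).
0 defs, 0 facts, 0 sorry.  Not claimed: the other places of THEOREM B (p11's `KolyvaginDerivativeUnramified*`,
p15's transverse files), the `fs_rel` clause (p11 C5), or that any particular Euler system exists.
References: K. Rubin, *Euler Systems*, Annals of Math. Studies 147 (2000), Def. 4.4.1, Def. 4.4.4,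
Lemma 4.4.2; B. Mazur, K. Rubin, *Kolyvagin systems*, Mem. AMS 799 (2004), App. A, Prop. A.2;
J.-P. Serre, *Galois Cohomology* (1997), I.§2.2–2.4, I.§5.1.
-/

noncomputable section

open CategoryTheory Finset Field
open Literature.NumberTheory.GaloisRepresentations

universe u v

namespace Summit.BirchSwinnertonDyer.Rank1Residual.GaloisImage.Derivative.CoeffChange

variable {R : Type u} [Ring R] [TopologicalSpace R]
variable {G : Type v} [Group G] [TopologicalSpace G] [IsTopologicalGroup G]
variable {X Y Z : TopRep.{v} R G}

/-- `map id π` on `H¹` is computed on cocycles by `π`: the hypothesis shape `hΦ` of the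
`CoeffTransport` naturality lemmas, for the push-forward along a morphism of representations.
[folklore] -/
theorem map_id_oneCocycleClass (π : X ⟶ Y) (φ : contOneCocycles X) (ψ : contOneCocycles Y)
    (h : ∀ g, ψ.1 g = (π.hom : X →+ Y) (φ.1 g)) :
    ContinuousCohomology.map (ContinuousMonoidHom.id G) (X := X) (Y := Y) π 1 (oneCocycleClass X φ) =
      oneCocycleClass Y ψ := by
  rw [map_oneCocycleClass]
  congr 1
  apply Subtype.ext
  ext g
  rw [contOneCocycles.pullback_apply, h g]
  rfl

/-- **Functoriality of `H¹` push-forwards on classes**: `(π ≫ π′)_* = π′_* ∘ π_*` (computed on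
cocycles). [folklore] -/
theorem map_id_comp_apply (π : X ⟶ Y) (π' : Y ⟶ Z) (c : continuousCohomology 1 X) :
    ContinuousCohomology.map (ContinuousMonoidHom.id G) (X := X) (Y := Z) (π ≫ π') 1 c =
      ContinuousCohomology.map (ContinuousMonoidHom.id G) (X := Y) (Y := Z) π' 1
        (ContinuousCohomology.map (ContinuousMonoidHom.id G) (X := X) (Y := Y) π 1 c) := by
  obtain ⟨φ, rfl⟩ := oneCocycleClass_surjective X c
  rw [map_oneCocycleClass, map_oneCocycleClass, map_oneCocycleClass]
  congr 1

variable (U : Subgroup G)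

/-- **Push-forward commutes with restriction to a subgroup**: `π_* ∘ res_U = res_U ∘ π_*` on `H¹`
(`CoeffTransport.comm_resSubgroup` for the transport computed on cocycles by `π`). [folklore] -/
theorem map_resSubgroup_comm (π : X ⟶ Y) (κ : continuousCohomology 1 X) :
    ContinuousCohomology.map (ContinuousMonoidHom.id U) (X := subgroupRep X U) (Y := subgroupRep Y U)
        ((TopRep.resFunctor U.subtype).map π) 1 (resSubgroup X U 1 κ) =
      resSubgroup Y U 1 (ContinuousCohomology.map (ContinuousMonoidHom.id G) (X := X) (Y := Y) π 1 κ) := by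
  obtain ⟨φ, rfl⟩ := oneCocycleClass_surjective X κ
  rw [resSubgroup_oneCocycleClass,
    map_id_oneCocycleClass π φ ⟨_, CoeffTransport.comp_mem_contOneCocycles X Y (π.hom : X →+ Y)
      π.hom.continuous (fun g x => TopRep.hom_comm_apply π g x) φ⟩ (fun _ => rfl),
    resSubgroup_oneCocycleClass]
  exact map_id_oneCocycleClass _ _ _ fun _ => rfl

/-- **Push-forward intertwines Kolyvagin's derivative operators**: for a normal subgroup `U`,
elements `σ_ℓ` and lengths `N_ℓ`, `π_* (D_r x) = D_r (π_* x)` on `H¹(U, ·)`,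
`D_r = ∏_{ℓ ∈ r} Σ_{j < N_ℓ} j σ_ℓ^j` (`CoeffTransport.comm_noncommProd_deriv_conjMap` for the transport
computed on cocycles by `π`).  Rubin, *Euler Systems* (2000), Def. 4.4.1. [folklore] -/
theorem map_noncommProd_deriv_comm [U.Normal] (π : X ⟶ Y) {ι : Type*} (σ : ι → G) (N : ι → ℕ)
    (r : Finset ι) (comm) (comm') (x : continuousCohomology 1 (subgroupRep X U)) :
    ContinuousCohomology.map (ContinuousMonoidHom.id U) (X := subgroupRep X U) (Y := subgroupRep Y U)
        ((TopRep.resFunctor U.subtype).map π) 1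
        ((r.noncommProd (fun ℓ => ∑ j ∈ Finset.range (N ℓ),
          (j : Module.End R (continuousCohomology 1 (subgroupRep X U))) *
            (conjMap X U (σ ℓ) 1).hom.toLinearMap ^ j) comm) x) =
      (r.noncommProd (fun ℓ => ∑ j ∈ Finset.range (N ℓ),
          (j : Module.End R (continuousCohomology 1 (subgroupRep Y U))) *
            (conjMap Y U (σ ℓ) 1).hom.toLinearMap ^ j) comm')
        (ContinuousCohomology.map (ContinuousMonoidHom.id U) (X := subgroupRep X U)
          (Y := subgroupRep Y U) ((TopRep.resFunctor U.subtype).map π) 1 x) := by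
  set Φ : continuousCohomology 1 (subgroupRep X U) →+ continuousCohomology 1 (subgroupRep Y U) :=
    AddMonoidHom.mk' (fun c => ContinuousCohomology.map (ContinuousMonoidHom.id U)
      (X := subgroupRep X U) (Y := subgroupRep Y U) ((TopRep.resFunctor U.subtype).map π) 1 c)
      (fun a b => map_add _ a b) with hΦ_def
  exact CoeffTransport.comm_noncommProd_deriv_conjMap X Y (π.hom : X →+ Y) U σ N r Φ
    (fun φ ψ h => map_id_oneCocycleClass _ φ ψ h) π.hom.continuous
    (fun g x => TopRep.hom_comm_apply π g x) comm comm' x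

/-- **Kolyvagin derivative classes under a change of coefficients (the witness identity).**  Let
`π : X ⟶ Y` be a morphism of representations (a coefficient map), `U` a normal subgroup,
`D_r = ∏_{ℓ∈r} Σ_{j<N_ℓ} j σ_ℓ^j` Kolyvagin's derivative operator on `H¹(U, ·)` and `x ∈ H¹(U, X)`
(intended: the image of the Euler-system class `c_r`).  If `κ ∈ H¹(G, X)` restricts to `D_r x` (the
defining property of the derivative class with coefficients `X`, THEOREM A3
`Derivative.existsUnique_res_eq_deriv`), then `π_* κ` restricts to `D_r (π_* x)` — the defining
property with coefficients `Y`.  Rubin, *Euler Systems* (2000), Def. 4.4.4. [folklore] -/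
theorem resSubgroup_map_eq_noncommProd_deriv [U.Normal] (π : X ⟶ Y)
    {ι : Type*} (σ : ι → G) (N : ι → ℕ) (r : Finset ι) (comm) (comm')
    (x : continuousCohomology 1 (subgroupRep X U)) (κ : continuousCohomology 1 X)
    (hκ : resSubgroup X U 1 κ =
      (r.noncommProd (fun ℓ => ∑ j ∈ Finset.range (N ℓ),
          (j : Module.End R (continuousCohomology 1 (subgroupRep X U))) *
            (conjMap X U (σ ℓ) 1).hom.toLinearMap ^ j) comm) x) :
    resSubgroup Y U 1 (ContinuousCohomology.map (ContinuousMonoidHom.id G) (X := X) (Y := Y) π 1 κ) =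
      (r.noncommProd (fun ℓ => ∑ j ∈ Finset.range (N ℓ),
          (j : Module.End R (continuousCohomology 1 (subgroupRep Y U))) *
            (conjMap Y U (σ ℓ) 1).hom.toLinearMap ^ j) comm')
        (ContinuousCohomology.map (ContinuousMonoidHom.id U) (X := subgroupRep X U)
          (Y := subgroupRep Y U) ((TopRep.resFunctor U.subtype).map π) 1 x) := by
  rw [← map_resSubgroup_comm, hκ, map_noncommProd_deriv_comm U π σ N r comm comm']

/-- **The derivative class with smaller coefficients is the push-forward of the one with larger
coefficients**: with the data of `resSubgroup_map_eq_noncommProd_deriv`, if the derivative class with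
coefficients `Y` for the datum `π_* x` is UNIQUE (THEOREM A3's `∃!`, from `Y^{U} = 0`), it equals
`π_* κ`.  Rubin, *Euler Systems* (2000), Def. 4.4.4 and Lemma 4.4.2. [folklore] -/
theorem map_eq_of_existsUnique_res_eq_deriv [U.Normal] (π : X ⟶ Y)
    {ι : Type*} (σ : ι → G) (N : ι → ℕ) (r : Finset ι) (comm) (comm')
    (x : continuousCohomology 1 (subgroupRep X U)) (κ : continuousCohomology 1 X)
    (hκ : resSubgroup X U 1 κ =
      (r.noncommProd (fun ℓ => ∑ j ∈ Finset.range (N ℓ),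
          (j : Module.End R (continuousCohomology 1 (subgroupRep X U))) *
            (conjMap X U (σ ℓ) 1).hom.toLinearMap ^ j) comm) x)
    (y : continuousCohomology 1 (subgroupRep Y U))
    (hy : ContinuousCohomology.map (ContinuousMonoidHom.id U) (X := subgroupRep X U)
      (Y := subgroupRep Y U) ((TopRep.resFunctor U.subtype).map π) 1 x = y)
    (huniq : ∃! κ' : continuousCohomology 1 Y, resSubgroup Y U 1 κ' =
      (r.noncommProd (fun ℓ => ∑ j ∈ Finset.range (N ℓ),
          (j : Module.End R (continuousCohomology 1 (subgroupRep Y U))) *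
            (conjMap Y U (σ ℓ) 1).hom.toLinearMap ^ j) comm') y)
    (κ' : continuousCohomology 1 Y)
    (hκ' : resSubgroup Y U 1 κ' =
      (r.noncommProd (fun ℓ => ∑ j ∈ Finset.range (N ℓ),
          (j : Module.End R (continuousCohomology 1 (subgroupRep Y U))) *
            (conjMap Y U (σ ℓ) 1).hom.toLinearMap ^ j) comm') y) :
    ContinuousCohomology.map (ContinuousMonoidHom.id G) (X := X) (Y := Y) π 1 κ = κ' :=
  huniq.unique (hy ▸ resSubgroup_map_eq_noncommProd_deriv U π σ N r comm comm' x κ hκ) hκ'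

end Summit.BirchSwinnertonDyer.Rank1Residual.GaloisImage.Derivative.CoeffChange

/-! ## §2 `E/F`: the derivative classes in `H¹(Γ_F, E[M])` read off `T_pE` at two coefficient levels -/

namespace Summit.BirchSwinnertonDyer.Rank1Residual.GaloisImage.Derivative.CoeffChange.EC

open Literature.NumberTheory.EllipticCurves WeierstrassCurve TateModule
open Summit.BirchSwinnertonDyer.Rank1Residual.GaloisImage.Derivative.CoeffChange

variable {F : Type} [Field F] (W : WeierstrassCurve F) (p : ℕ) [Fact p.Prime]
  [ContinuousSMul ℤ_[p] (W.tateModule p)]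
  (h : Continuous fun x : absoluteGaloisGroup F × W.tateModule p => W.galoisRepTate p x.1 x.2)

/-- The level-`j` coefficient map on cocycles `a ↦ a_j ∈ E[M]` (for `E[p^j] = E[M]`) is additive,
continuous and `Γ_F`-equivariant, so it pushes continuous crossed homomorphisms of `T_pE|_U` to
continuous crossed homomorphisms of `E[M]|_U` (`CoeffTransport.comp_mem_contOneCocycles`). [folklore] -/
theorem comp_proj_mem_contOneCocycles (j : ℕ) {M : ℤ} (hM : geomTorsion W ((p ^ j : ℕ) : ℤ) = geomTorsion W M)
    (U : Subgroup (absoluteGaloisGroup F))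
    (φ : contOneCocycles (subgroupRep (W.tateGaloisRep p h).toTopRep U)) :
    ∃ ψ : contOneCocycles (subgroupRep (W.torsionGaloisModule M).toTopRep U),
      ∀ g, ((ψ.1 g : geomTorsion W M) : geomPoints W) = proj p j (φ.1 g) := by
  let e : (subgroupRep (W.tateGaloisRep p h).toTopRep U) →+ (subgroupRep (W.torsionGaloisModule M).toTopRep U) :=
    (AddSubgroup.inclusion hM.le : _ →+ _).comp
      ((proj p j).codRestrict (geomTorsion W ((p ^ j : ℕ) : ℤ)) (proj_mem_torsionBy j))
  have hq : Continuous fun a : W.tateModule p =>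
      (⟨proj p j a, proj_mem_torsionBy j a⟩ : geomTorsion W ((p ^ j : ℕ) : ℤ)) :=
    (continuous_proj j).subtype_mk _
  have hec : Continuous e :=
    (continuous_of_discreteTopology (f := (AddSubgroup.inclusion hM.le :
      geomTorsion W ((p ^ j : ℕ) : ℤ) → geomTorsion W M))).comp hq
  have he : ∀ (g : U) (x : subgroupRep (W.tateGaloisRep p h).toTopRep U),
      e ((subgroupRep (W.tateGaloisRep p h).toTopRep U).ρ g x) =
        (subgroupRep (W.torsionGaloisModule M).toTopRep U).ρ g (e x) := fun _ _ => rfl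
  exact ⟨⟨_, CoeffTransport.comp_mem_contOneCocycles _ _ e hec he φ⟩, fun _ => rfl⟩

/-- **THEOREM A3's derivative class of depth `p^{k+1}` IS the reduction of the one of depth `p^{m+1}`
(`k ≤ m`), in `H¹(Γ_F, E[M])` currency.**  Data: the `T_pE`-class `c ∈ H¹(U, T_pE)` (intended: the
Euler-system class `c_r` restricted to the level `U = Gal(F̄/F(r))`), generators `σ_ℓ`, lengths `N_ℓ`,
the derivative operator `D_r = ∏ Σ_{j<N_ℓ} j σ_ℓ^j`, additive maps `Ψ_m : H¹(U, T_pE) → H¹(U, E[M_m])`,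
`Ψ_k : H¹(U, T_pE) → H¹(U, E[M_k])` computed on cocycles by `a ↦ a_{m+1}`, `a ↦ a_{k+1}`
(`E[p^{m+1}] = E[M_m]`, `E[p^{k+1}] = E[M_k]`; e.g. GZ-2's `Φ ∘ red_*`), a coefficient map
`π : E[M_m] → E[M_k]` acting as `p^{m−k}` (`hπ`), the derivative class `κ_m` with coefficients `E[M_m]`
(`res_U κ_m = D_r (Ψ_m c)`), and the UNIQUE (`huniq`, THEOREM A3 from `E[M_k]^U = 0`) derivative class
`κ_k` with coefficients `E[M_k]`.  THEN `π_* κ_m = κ_k`.  Rubin, *Euler Systems* (2000), Def. 4.4.4,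
Lemma 4.4.2; the explicit statement is this file's. [folklore] -/
theorem map_eq_of_res_eq_deriv {m k : ℕ} (hkm : k ≤ m) {Mm Mk : ℤ}
    (hMm : geomTorsion W ((p ^ (m + 1) : ℕ) : ℤ) = geomTorsion W Mm)
    (hMk : geomTorsion W ((p ^ (k + 1) : ℕ) : ℤ) = geomTorsion W Mk)
    (π : (W.torsionGaloisModule Mm).toTopRep ⟶ (W.torsionGaloisModule Mk).toTopRep)
    (hπ : ∀ x : geomTorsion W Mm,
      (((π.hom : geomTorsion W Mm → geomTorsion W Mk) x : geomTorsion W Mk) : geomPoints W) =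
        ((p : ℤ) ^ (m - k)) • (x : geomPoints W))
    (U : Subgroup (absoluteGaloisGroup F)) [U.Normal] {ι : Type*} (σ : ι → absoluteGaloisGroup F)
    (N : ι → ℕ) (r : Finset ι) (commm) (commk)
    (c : continuousCohomology 1 (subgroupRep (W.tateGaloisRep p h).toTopRep U))
    (Ψm : continuousCohomology 1 (subgroupRep (W.tateGaloisRep p h).toTopRep U) →+
      continuousCohomology 1 (subgroupRep (W.torsionGaloisModule Mm).toTopRep U))
    (hΨm : ∀ (φ : contOneCocycles (subgroupRep (W.tateGaloisRep p h).toTopRep U))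
      (ψ : contOneCocycles (subgroupRep (W.torsionGaloisModule Mm).toTopRep U)),
      (∀ g, ((ψ.1 g : geomTorsion W Mm) : geomPoints W) = proj p (m + 1) (φ.1 g)) →
        Ψm (oneCocycleClass _ φ) = oneCocycleClass _ ψ)
    (Ψk : continuousCohomology 1 (subgroupRep (W.tateGaloisRep p h).toTopRep U) →+
      continuousCohomology 1 (subgroupRep (W.torsionGaloisModule Mk).toTopRep U))
    (hΨk : ∀ (φ : contOneCocycles (subgroupRep (W.tateGaloisRep p h).toTopRep U))
      (ψ : contOneCocycles (subgroupRep (W.torsionGaloisModule Mk).toTopRep U)),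
      (∀ g, ((ψ.1 g : geomTorsion W Mk) : geomPoints W) = proj p (k + 1) (φ.1 g)) →
        Ψk (oneCocycleClass _ φ) = oneCocycleClass _ ψ)
    (κm : continuousCohomology 1 (W.torsionGaloisModule Mm).toTopRep)
    (hκm : resSubgroup (W.torsionGaloisModule Mm).toTopRep U 1 κm =
      (r.noncommProd (fun ℓ => ∑ j ∈ Finset.range (N ℓ),
          (j : Module.End ℤ (continuousCohomology 1 (subgroupRep (W.torsionGaloisModule Mm).toTopRep U))) *
            (conjMap (W.torsionGaloisModule Mm).toTopRep U (σ ℓ) 1).hom.toLinearMap ^ j) commm) (Ψm c))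
    (huniq : ∃! κ' : continuousCohomology 1 (W.torsionGaloisModule Mk).toTopRep,
      resSubgroup (W.torsionGaloisModule Mk).toTopRep U 1 κ' =
      (r.noncommProd (fun ℓ => ∑ j ∈ Finset.range (N ℓ),
          (j : Module.End ℤ (continuousCohomology 1 (subgroupRep (W.torsionGaloisModule Mk).toTopRep U))) *
            (conjMap (W.torsionGaloisModule Mk).toTopRep U (σ ℓ) 1).hom.toLinearMap ^ j) commk) (Ψk c))
    (κk : continuousCohomology 1 (W.torsionGaloisModule Mk).toTopRep)
    (hκk : resSubgroup (W.torsionGaloisModule Mk).toTopRep U 1 κk =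
      (r.noncommProd (fun ℓ => ∑ j ∈ Finset.range (N ℓ),
          (j : Module.End ℤ (continuousCohomology 1 (subgroupRep (W.torsionGaloisModule Mk).toTopRep U))) *
            (conjMap (W.torsionGaloisModule Mk).toTopRep U (σ ℓ) 1).hom.toLinearMap ^ j) commk) (Ψk c)) :
    ContinuousCohomology.map (ContinuousMonoidHom.id (absoluteGaloisGroup F))
      (X := (W.torsionGaloisModule Mm).toTopRep) (Y := (W.torsionGaloisModule Mk).toTopRep) π 1 κm = κk := by
  refine map_eq_of_existsUnique_res_eq_deriv U π σ N r commm commk (Ψm c) κm hκm (Ψk c) ?_ huniq κk hκk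
  obtain ⟨φ, rfl⟩ := oneCocycleClass_surjective _ c
  obtain ⟨ψm, hψm⟩ := comp_proj_mem_contOneCocycles W p h (m + 1) hMm U φ
  obtain ⟨ψk, hψk⟩ := comp_proj_mem_contOneCocycles W p h (k + 1) hMk U φ
  rw [hΨm φ ψm hψm, hΨk φ ψk hψk]
  refine map_id_oneCocycleClass _ ψm ψk fun g => Subtype.ext ?_
  change ((ψk.1 g : geomTorsion W Mk) : geomPoints W) =
    (((π.hom : geomTorsion W Mm → geomTorsion W Mk) (ψm.1 g) : geomTorsion W Mk) : geomPoints W)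
  rw [hπ, hψk, hψm, ← Nat.cast_pow, natCast_zsmul, show m + 1 = k + 1 + (m - k) by omega,
    pow_smul_proj_add]

end Summit.BirchSwinnertonDyer.Rank1Residual.GaloisImage.Derivative.CoeffChange.EC

/-! ## §3 `E/ℚ`, `p = 3`, additive reduction at `3`: THEOREM B at the place `3` for the DERIVATIVE
CLASS of depth `3^{k+1}` itself (row T-DER-BP FILE 3b applied through §2) -/

namespace Summit.BirchSwinnertonDyer.Rank1Residual.GaloisImage.Derivative.CoeffChange.EC

open Literature.NumberTheory.EllipticCurves WeierstrassCurve TateModule IsDedekindDomain NumberField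
open scoped NumberField ContRepresentation

/-- **THEOREM B of row T-DER AT THE PLACE `3` FOR KOLYVAGIN'S DERIVATIVE CLASS OF DEPTH `3^{k+1}`, on
every additive row, binder-free.**  For `E/ℚ` with additive reduction at the place `v ∣ 3`, depths
`k + 2 ≤ m`, a level `U` (normal) with generators `σ_ℓ`, lengths `N_ℓ`, a class `c ∈ H¹(U, T_3E)`
(intended: an Euler-system class `c_r`, `r ⊆ 𝒫_{m+1}`), transports `Ψ_m`, `Ψ_k` computed on cocycles by
`a ↦ a_{m+1} ∈ E[3^m·3]`, `a ↦ a_{k+1} ∈ E[3^k·3]`, the reduction `r : E[3^m·3] → E[3^k·3]`,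
`x ↦ 3^{m−k}x` (T-DER-BP's binder), the derivative class `κ_m ∈ H¹(ℚ, E[3^m·3])`
(`res_U κ_m = D_r (Ψ_m c)`) and THE derivative class `κ_k ∈ H¹(ℚ, E[3^k·3])` (`res_U κ_k = D_r (Ψ_k c)`,
unique — THEOREM A3's `∃!`): **`loc₃ κ_k ∈ 𝓕_can(E[3^k·3])₃`** — because `κ_k = r_* κ_m`
(`map_eq_of_res_eq_deriv`) and every reduction from depth `≥ k + 2` lands in the propagated condition
(T-DER-BP FILE 3b `localization_map_red_mem_propagatedSelmerStructure_three_of_hasAdditiveReductionAt`,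
Mazur–Rubin Prop. A.2 with the explicit depth).  No Euler-system axiom is used: only the SHAPE of the
derivative classes.  This is DICT3's clause C0 at `v₃` for the depth-`k` classes on `t ≥ 1` rows
(ROUTE-1 §47 D-N₀: primes of level `≥ k + 2`). [cite: MazurRubin2004, App. A, Prop. A.2 (p. 79)] -/
theorem localization_mem_propagatedSelmerStructure_three_of_res_eq_deriv_of_hasAdditiveReductionAt
    (W : WeierstrassCurve ℚ) [W.IsElliptic] [ContinuousSMul ℤ_[3] (W.tateModule 3)]
    (h : Continuous fun x : absoluteGaloisGroup ℚ × W.tateModule 3 => W.galoisRepTate 3 x.1 x.2)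
    {v : HeightOneSpectrum (𝓞 ℚ)} (hv : (Rat.HeightOneSpectrum.primesEquiv v : ℕ) = 3)
    (hadd : W.HasAdditiveReductionAt v) {k m : ℕ} (hkm : k + 2 ≤ m)
    (r : (W.torsionGaloisModule (((3 : ℕ) : ℤ) ^ m * ((3 : ℕ) : ℤ))).toContRepresentation →ⁱL
      (W.torsionGaloisModule (((3 : ℕ) : ℤ) ^ k * ((3 : ℕ) : ℤ))).toContRepresentation)
    (hr : ∀ x : geomTorsion W (((3 : ℕ) : ℤ) ^ m * ((3 : ℕ) : ℤ)),
      ((r x : geomTorsion W (((3 : ℕ) : ℤ) ^ k * ((3 : ℕ) : ℤ))) : geomPoints W) =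
        (((3 : ℕ) : ℤ) ^ (m - k)) • (x : geomPoints W))
    (U : Subgroup (absoluteGaloisGroup ℚ)) [U.Normal] {ι : Type*} (σ : ι → absoluteGaloisGroup ℚ)
    (N : ι → ℕ) (rr : Finset ι) (commm) (commk)
    (c : continuousCohomology 1 (subgroupRep (W.tateGaloisRep 3 h).toTopRep U))
    (Ψm : continuousCohomology 1 (subgroupRep (W.tateGaloisRep 3 h).toTopRep U) →+
      continuousCohomology 1
        (subgroupRep (W.torsionGaloisModule (((3 : ℕ) : ℤ) ^ m * ((3 : ℕ) : ℤ))).toTopRep U))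
    (hΨm : ∀ (φ : contOneCocycles (subgroupRep (W.tateGaloisRep 3 h).toTopRep U))
      (ψ : contOneCocycles
        (subgroupRep (W.torsionGaloisModule (((3 : ℕ) : ℤ) ^ m * ((3 : ℕ) : ℤ))).toTopRep U)),
      (∀ g, ((ψ.1 g : geomTorsion W _) : geomPoints W) = proj 3 (m + 1) (φ.1 g)) →
        Ψm (oneCocycleClass _ φ) = oneCocycleClass _ ψ)
    (Ψk : continuousCohomology 1 (subgroupRep (W.tateGaloisRep 3 h).toTopRep U) →+
      continuousCohomology 1
        (subgroupRep (W.torsionGaloisModule (((3 : ℕ) : ℤ) ^ k * ((3 : ℕ) : ℤ))).toTopRep U))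
    (hΨk : ∀ (φ : contOneCocycles (subgroupRep (W.tateGaloisRep 3 h).toTopRep U))
      (ψ : contOneCocycles
        (subgroupRep (W.torsionGaloisModule (((3 : ℕ) : ℤ) ^ k * ((3 : ℕ) : ℤ))).toTopRep U)),
      (∀ g, ((ψ.1 g : geomTorsion W _) : geomPoints W) = proj 3 (k + 1) (φ.1 g)) →
        Ψk (oneCocycleClass _ φ) = oneCocycleClass _ ψ)
    (κm : galoisCohomology (W.torsionGaloisModule (((3 : ℕ) : ℤ) ^ m * ((3 : ℕ) : ℤ))) 1)
    (hκm : resSubgroup (W.torsionGaloisModule (((3 : ℕ) : ℤ) ^ m * ((3 : ℕ) : ℤ))).toTopRep U 1 κm =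
      (rr.noncommProd (fun ℓ => ∑ j ∈ Finset.range (N ℓ),
          (j : Module.End ℤ (continuousCohomology 1
            (subgroupRep (W.torsionGaloisModule (((3 : ℕ) : ℤ) ^ m * ((3 : ℕ) : ℤ))).toTopRep U))) *
            (conjMap (W.torsionGaloisModule (((3 : ℕ) : ℤ) ^ m * ((3 : ℕ) : ℤ))).toTopRep U (σ ℓ)
              1).hom.toLinearMap ^ j) commm) (Ψm c))
    (huniq : ∃! κ' : galoisCohomology (W.torsionGaloisModule (((3 : ℕ) : ℤ) ^ k * ((3 : ℕ) : ℤ))) 1,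
      resSubgroup (W.torsionGaloisModule (((3 : ℕ) : ℤ) ^ k * ((3 : ℕ) : ℤ))).toTopRep U 1 κ' =
      (rr.noncommProd (fun ℓ => ∑ j ∈ Finset.range (N ℓ),
          (j : Module.End ℤ (continuousCohomology 1
            (subgroupRep (W.torsionGaloisModule (((3 : ℕ) : ℤ) ^ k * ((3 : ℕ) : ℤ))).toTopRep U))) *
            (conjMap (W.torsionGaloisModule (((3 : ℕ) : ℤ) ^ k * ((3 : ℕ) : ℤ))).toTopRep U (σ ℓ)
              1).hom.toLinearMap ^ j) commk) (Ψk c))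
    (κk : galoisCohomology (W.torsionGaloisModule (((3 : ℕ) : ℤ) ^ k * ((3 : ℕ) : ℤ))) 1)
    (hκk : resSubgroup (W.torsionGaloisModule (((3 : ℕ) : ℤ) ^ k * ((3 : ℕ) : ℤ))).toTopRep U 1 κk =
      (rr.noncommProd (fun ℓ => ∑ j ∈ Finset.range (N ℓ),
          (j : Module.End ℤ (continuousCohomology 1
            (subgroupRep (W.torsionGaloisModule (((3 : ℕ) : ℤ) ^ k * ((3 : ℕ) : ℤ))).toTopRep U))) *
            (conjMap (W.torsionGaloisModule (((3 : ℕ) : ℤ) ^ k * ((3 : ℕ) : ℤ))).toTopRep U (σ ℓ)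
              1).hom.toLinearMap ^ j) commk) (Ψk c)) :
    galoisCohomology.localization (W.torsionGaloisModule (((3 : ℕ) : ℤ) ^ k * ((3 : ℕ) : ℤ)))
        (Sum.inr v : Place ℚ) 1 κk ∈ propagatedSelmerStructure W 3 k (Sum.inr v) := by
  have hMm : geomTorsion W ((3 ^ (m + 1) : ℕ) : ℤ) = geomTorsion W (((3 : ℕ) : ℤ) ^ m * ((3 : ℕ) : ℤ)) := by
    rw [show (((3 : ℕ) : ℤ) ^ m * ((3 : ℕ) : ℤ)) = ((3 ^ (m + 1) : ℕ) : ℤ) by push_cast; ring]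
  have hMk : geomTorsion W ((3 ^ (k + 1) : ℕ) : ℤ) = geomTorsion W (((3 : ℕ) : ℤ) ^ k * ((3 : ℕ) : ℤ)) := by
    rw [show (((3 : ℕ) : ℤ) ^ k * ((3 : ℕ) : ℤ)) = ((3 ^ (k + 1) : ℕ) : ℤ) by push_cast; ring]
  have hκ := map_eq_of_res_eq_deriv W 3 h (by omega : k ≤ m) hMm hMk
    (TopRep.ofHom ⟨r.toContinuousLinearMap, r.isIntertwining'⟩) (fun x => hr x) U σ N rr commm commk c
    Ψm hΨm Ψk hΨk κm hκm huniq κk hκk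
  rw [← hκ]
  exact localization_map_red_mem_propagatedSelmerStructure_three_of_hasAdditiveReductionAt W hv hadd
    k m hkm r hr κm

end Summit.BirchSwinnertonDyer.Rank1Residual.GaloisImage.Derivative.CoeffChange.EC



end
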